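import Summits.Ventures.PercRepro.RankLevelSetPerElemNullity
import Summits.Ventures.PercRepro.RankLevelSetPerElemFour

/-! # RankLevelSetPerElemNullityAll — (★★) AT EVERY LEVEL AND MONO ON EVERY MATROID OF NULLITY AT MOST `4`
(night-1 g36; dossier §48.16; on `RankLevelSetPerElemNullity` and `RankLevelSetPerElemFour`)

The simple coloop-free case is `perElemAt_of_coloopFree_of_nullity`; the rest is the reduction of g25/g35 run as a
strong induction on `#E` inside the class (the dual rank never goes up under the minors used:
**`eRank_dual_contract_delete_le`**, **`eRank_dual_delete_le`** — a base of the minor's dual is independent in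
`M✶`): a loop kills every level (`biIndep_eq_empty_of_isLoop`); a parallel pair `{u, v}` reduces level `j + 1` to
level `j` of `N = M ／ {u} ＼ {v}` (at `u` itself to `D_j(N) ≤ D_{j+1}(N)`, which is Mono of `N` from its own (★★)
by induction); a coloop `x` reduces level `j + 1` to the levels `j`, `j + 1` of `M ＼ {x}` (at `x` itself an
equality; at the middle of `M ＼ {x}` an equality). The result: **`biIndepPerElem_of_nullity`** and
**`biIndepMono_of_nullity`** — `M✶.eRank ≤ 4 → BiIndepPerElem M` / `BiIndepMono M`, the dual companion of
`biIndepPerElem_of_eRank_le_six` / `biIndepMono_of_eRank_le_six`. Every declaration has a docstring; imports: the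
cell's own modules and Mathlib only. Axioms: standard. -/

namespace PercRepro

open Set Matroid

variable {α : Type} (M : Matroid α) [M.Finite]

/-! ## The dual rank of the minors -/

omit [M.Finite] in
/-- **The dual rank does not go up under a contraction followed by a deletion**: a base of
`(M ／ C ＼ D)✶ = M✶ ＼ C ／ D` is independent in `M✶`. -/
lemma eRank_dual_contract_delete_le (C D : Set α) : ((M.contract C).delete D)✶.eRank ≤ M✶.eRank := by
  obtain ⟨B, hB⟩ := ((M.contract C).delete D)✶.exists_isBase
  rw [← hB.encard_eq_eRank]
  have hB' : ((M.contract C).delete D)✶.Indep B := hB.indep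
  rw [Matroid.dual_contract_delete] at hB'
  exact hB'.of_contract.of_delete.encard_le_eRank

omit [M.Finite] in
/-- **The dual rank does not go up under a deletion**: a base of `(M ＼ D)✶ = M✶ ／ D` is independent in `M✶`. -/
lemma eRank_dual_delete_le (D : Set α) : (M.delete D)✶.eRank ≤ M✶.eRank := by
  obtain ⟨B, hB⟩ := (M.delete D)✶.exists_isBase
  rw [← hB.encard_eq_eRank]
  have hB' : (M.delete D)✶.Indep B := hB.indep
  rw [Matroid.dual_delete] at hB'
  exact hB'.of_contract.encard_le_eRank

/-! ## The induction -/

/-- **(★★) AT EVERY LEVEL ON EVERY MATROID OF NULLITY `≤ 4`, by strong induction on `#E`** (the loop, parallel and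
coloop reductions; the simple coloop-free case is `perElemAt_of_coloopFree_of_nullity`). -/
theorem perElemAt_of_nullity_aux :
    ∀ n : ℕ, ∀ (M' : Matroid α) [M'.Finite], M'.E.ncard = n → M'✶.eRank ≤ 4 → ∀ y ∈ M'.E, ∀ j : ℕ,
      2 * j + 1 < n → {Z ∈ biIndep M' j | y ∉ Z}.ncard ≤ {Q ∈ biIndep M' (j + 1) | y ∈ Q}.ncard := by
  intro n
  induction n using Nat.strong_induction_on with
  | _ n ih =>
    intro M' _ hn hν y hy j hj
    -- a loop anywhere
    by_cases hloop : ∃ ℓ, M'.IsLoop ℓ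
    · obtain ⟨ℓ, hℓ⟩ := hloop
      have : {Z ∈ biIndep M' j | y ∉ Z} = ∅ := by
        rw [biIndep_eq_empty_of_isLoop M' hℓ j]
        ext Z; simp
      rw [this, Set.ncard_empty]
      exact Nat.zero_le _
    simp only [not_exists] at hloop
    -- level `0`
    rcases Nat.eq_zero_or_pos j with rfl | hj0
    · exact perElemAt_zero M' hy
    obtain ⟨j, rfl⟩ : ∃ j', j = j' + 1 := ⟨j - 1, by omega⟩
    -- a parallel pair anywhere
    by_cases hpar : ∃ u v, ParallelPair M' u v
    · obtain ⟨u, v, huv⟩ := hpar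
      haveI := contract_delete_finite M' u v
      have hcard := ncard_ground_contract_delete M' huv
      have hN : ∀ {u v : α} (h : ParallelPair M' u v), BiIndepPerElem ((M'.contract {u}).delete {v}) := by
        intro u v h
        haveI := contract_delete_finite M' u v
        have hc := ncard_ground_contract_delete M' h
        intro y' hy' j' hj'
        rw [hn] at hc
        rw [hc] at hj'
        exact ih (n - 2) (by omega) _ hc (le_trans (eRank_dual_contract_delete_le M' _ _) hν) y' hy' j' hj'
      have hD : ∀ {u v : α} (h : ParallelPair M' u v),
          biIndepCount ((M'.contract {u}).delete {v}) j ≤ biIndepCount ((M'.contract {u}).delete {v}) (j + 1) := by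
        intro u v h
        haveI := contract_delete_finite M' u v
        have hc := ncard_ground_contract_delete M' h
        exact biIndepCount_le_succ_of_mono _ (biIndepMono_of_perElem _ (hN h)) (by rw [hc]; omega)
      by_cases hyu : y = u
      · subst hyu
        exact perElem_succ_of_parallel_self M' huv j (hD huv)
      by_cases hyv : y = v
      · subst hyv
        exact perElem_succ_of_parallel_self M' huv.symm j (hD huv.symm)
      · have hyN : y ∈ ((M'.contract {u}).delete {v}).E := by
          rw [ground_contract_delete]
          exact ⟨hy, by simp only [Set.mem_insert_iff, Set.mem_singleton_iff, not_or]; exact ⟨hyu, hyv⟩⟩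
        exact perElem_succ_of_parallel_other M' huv hyu hyv j (hN huv y hyN j (by rw [hcard]; omega))
    simp only [not_exists] at hpar
    -- a coloop anywhere
    by_cases hcol : ∃ x, M'.IsColoop x
    · obtain ⟨x, hx⟩ := hcol
      haveI := delete_finite' M' x
      have hcard : (M'.delete {x}).E.ncard = n - 1 := by
        rw [Matroid.delete_ground, Set.ncard_sdiff_singleton_of_mem hx.mem_ground, hn]
      have hν' : (M'.delete {x})✶.eRank ≤ 4 := le_trans (eRank_dual_delete_le M' _) hν
      by_cases hyx : y = x
      · subst hyx
        exact (perElem_coloop_self M' hx (j + 1)).le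
      · have hyM : y ∈ (M'.delete {x}).E := by
          rw [Matroid.delete_ground]
          exact ⟨hy, by simpa using hyx⟩
        refine perElem_succ_of_coloop M' hx hyx j
          (ih (n - 1) (by omega) _ hcard hν' y hyM j (by omega)) ?_
        rcases Nat.lt_or_ge (2 * (j + 1) + 1) (n - 1) with hlt | hge
        · exact ih (n - 1) (by omega) _ hcard hν' y hyM (j + 1) hlt
        · exact (perElem_middle_eq (M'.delete {x}) hyM (j + 1) (by omega)).le
    simp only [not_exists] at hcol
    exact perElemAt_of_coloopFree_of_nullity M' hcol hy
      (fun _ hz => notMem_closure_singleton_of_no_partner M' hy (hloop y) (hpar y) hz) hν (by omega)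

/-! ## The class theorems -/

/-- **(★★) HOLDS ON EVERY MATROID WHOSE DUAL HAS RANK `≤ 4`** (nullity `≤ 4`). -/
theorem biIndepPerElem_of_nullity (hν : M✶.eRank ≤ 4) : BiIndepPerElem M :=
  fun y hy j hj => perElemAt_of_nullity_aux M.E.ncard M rfl hν y hy j hj

/-- **MONO HOLDS ON EVERY MATROID WHOSE DUAL HAS RANK `≤ 4`** (nullity `≤ 4`). -/
theorem biIndepMono_of_nullity (hν : M✶.eRank ≤ 4) : BiIndepMono M :=
  biIndepMono_of_perElem M (biIndepPerElem_of_nullity M hν)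

end PercRepro
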